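/-
Copyright (c) 2026 the pub-hodgecm-mathlib formalisation cell (harness21).  Prover seat hodgecm-mathlib-K2E3-p06 (g6) (E3 hand lent to L1; LEAD F0P6-plan (g14) BATCH #106 (1);
desk K2E3-p14 (g9)), Track B «K2-LIT» ∕ hLiu418 = stmt-HodgeConjecture-24832: U1-CT-ind stage 3, brick B2a′, file W-FE-3 — the rank-one ψ-Whittaker functional equation
AT THE CENTRE: kernel transfer from the normalised intertwined family to the twisted stage (hypothesis-first on the evaluation letter of W-FE-2b).
THEOREMS ONLY (no `def`∕`instance`∕notation∕`sorry`).
-/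
import Summits.HodgeConjecture.HodgeConjecture.Theorems.K2LiuRankOneWhittakerFunctionalEquation   -- ★ W-FE-1b (this seat): `twistedHeadSum_intertwined_eq_mul`
import Summits.HodgeConjecture.HodgeConjecture.Theorems.K2LiuRankOneFamilies                     -- ★ B6 (K2Liu-p09 (g5)): `lFactor_sub_one_ne_zero`; ★ (a) `norm_unramValue_le_one`; ★ F1 `eq_of_eqOn_halfPlane`
import HarnessLib

/-!
# Crux `HLiu418`, organ U1-CT-ind STAGE 3 («U1-glob»), brick B2a′, file W-FE-3: THE RANK-ONE ψ-WHITTAKER FUNCTIONAL EQUATION AT THE CENTRE —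
# «the NORMALISED intertwined family vanishes at `s = ½` along `w₀ u(·) y`» ⟹ «the ψ_σ-twisted stage of the family vanishes at `s = ½` at `y`»
# [CasselmanShalika1980 §2–§4; Casselman1980 §3; KudlaSweet1997 §1; GanTakeda2011SiegelWeil §7 Lemma 7.4]

Cell `hodgecm-mathlib`, crux item hLiu418 = `stmt-HodgeConjecture-24832`; squad K2, strike line L1, LEAD F0P6-plan (g14); desk K2E3-p14 (g9) + K2Liu-p13 (g4);
prover K2E3-p06 (g6).  Lane `--supports stmt-HodgeConjecture-24832 --as helper` (count-neutral).  GROUP-ABSTRACT, HYPOTHESIS-FIRST: a FAMILY `Φ : ℂ → G → ℂ` in the letters of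
★ B7-S `K2LiuRankOneStage.exists_normalised_family` (right-`K′`-invariance, `hrel` with `e(s) = a·s + c` and `C₀(s)` on `1 < re s`, unitary `ν`), its NORMALISED intertwined
family `N` BY VALUE with ★ B7-S's two clauses (`∫ Φ_s(w₀ u(x) g) dμ = L(e(s) − 1, ν)·N_s(g)` on `1 < re s`; `s ↦ N_s(g)` regular at `½`), the Bruhat word (W), tail and conductor
letters of ★ W-FE-1b, and ONE EVALUATION LETTER for the scalar of the functional equation:
  «`Γ^M_σ(e(s)) = L(e(s) − 1, ν) · Γ̃(s)` on `1 < re s`, `Γ̃` rational in `q₀^{-s}` and regular at `½`, `Γ̃(½) ≠ 0`»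
— DISCHARGED for unramified `ν` (inert: `ν(ϖ) = −1`; split: `ν(ϖ) = 1`) by W-FE-2b over ★ W-FE-2a `K2LiuWhittakerGammaAsTateZeta` (`Γ` is Tate's zeta of `ψ(a·)𝟙_{ball}`), and for
ramified `ν` by the Gauss-sum shell (W-FE-2c).

THE POINT.  This is the (L-N1) replacement of the U1-glob census at a NON-SPLIT place, in final form: no injectivity of the centre operator `N^{(1)}(0)` is needed — the functional
equation of ★ W-FE-1b, `Σ_a c_a (A_{e(s)} Φ_s)(w₀ u(a) y) = Γ^M_σ(e(s)) · Σ_a c_a Φ_s(w₀ u(a) y)` (`c_a = μ(𝔭^m) conj ψ(σa)`, `1 < re s`), reads after `A_e = L(e−1,ν)·N` (★ B7-S) and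
the evaluation letter `L(e(s)−1,ν)·Σ_a c_a N_s(w₀u(a)y) = L(e(s)−1,ν)·Γ̃(s)·Σ_a c_a Φ_s(w₀u(a)y)`; `L(e−1,ν) ≠ 0` on the half-plane (★ `lFactor_sub_one_ne_zero`), so the two
REGULAR families `s ↦ Σ_a c_a N_s(w₀u(a)y)` and `s ↦ Γ̃(s)·Σ_a c_a Φ_s(w₀u(a)y)` agree on `1 < re s`, hence AT `½` (★ F1 `eq_of_eqOn_halfPlane`, the identity principle for rational
functions of `q₀^{-s}`); if the normalised family dies at `½` along `w₀u(·)y` (U1's kernel clause transported by ★ B2a-core `eq_zero_iff_of_presentation_mul` to ★ B7-S's `N`),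
then `Γ̃(½)·W(½) = 0` with `Γ̃(½) ≠ 0`:
  **`twistedHeadSum_half_eq_zero_of_normalised_half_eq_zero`**: `Σ_{a∈R} μ(𝔭^m) conj ψ(σa) Φ_{½}(w₀ u(a) y) = 0`
— the honest, truncation-stable ψ_σ-twisted stage of the two-step family at the centre (★ (K1a-3)-S's coset sum) VANISHES: B2b's `hFn0` ∕ ★ B4a's `hfac` kernel input at `v`.
Also: `twistedHeadSum_eq_mul_on_halfPlane` (the regular-family identity on `1 < re s`) and `twistedHeadSum_half_eq_mul` (its value at `½`).
References: [CasselmanShalika1980] W. Casselman, J. Shalika, Compositio Math. 41 (1980), §2–§4; [Casselman1980] W. Casselman, Compositio Math. 40 (1980), §3 Thm. 3.1;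
[KudlaSweet1997] S. Kudla, W. J. Sweet, Israel J. Math. 98 (1997), §1 (rationality in `q^{-s}`); [GanTakeda2011SiegelWeil] W. T. Gan, S. Takeda (2011), §7 Lemma 7.4;
[KudlaRallis1994] S. Kudla, S. Rallis, Ann. of Math. 140 (1994), §2.
HONEST LABEL.  Count-neutral helper: `HC_CM` is proved only modulo the 7 printed citations (2 remaining named inputs: hLiu418 = `stmt-HodgeConjecture-24832`,
h413 = `stmt-HodgeConjecture-24833`) until rung 0 closes; B2a′ OPEN modulo the evaluation letter (W-FE-2b unramified, W-FE-2c ramified) and the `U(2,2)_v` instantiation;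
this file closes no socket.
-/

set_option autoImplicit false
set_option linter.dupNamespace false -- the mandated namespace repeats `HodgeConjecture.HodgeConjecture`

noncomputable section

open MeasureTheory Filter Topology Set
open scoped NNReal ENNReal ComplexConjugate
open NumberField IsDedekindDomain
open Literature.NumberTheory.GaloisRepresentations.IsNonarchimedeanLocalField
open Literature.NumberTheory.Automorphic Literature.NumberTheory.Automorphic.LocalFieldHaar
open Summit.HodgeConjecture.HodgeConjecture.Cruxes.HLiu418.K2LiuQRationalDefs
open Summit.HodgeConjecture.HodgeConjecture.Cruxes.HLiu418.K2LiuLocalLFactorDefs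
open Summit.HodgeConjecture.HodgeConjecture.Cruxes.HLiu418.K2LiuQRationalLFactor
open Summit.HodgeConjecture.HodgeConjecture.Cruxes.HLiu418.K2LiuRankOneFamilies (lFactor_sub_one_ne_zero)
open Summit.HodgeConjecture.HodgeConjecture.Cruxes.HLiu418.K2LiuRankOneWhittakerFunctionalEquation (twistedHeadSum_intertwined_eq_mul)

namespace Summit.HodgeConjecture.HodgeConjecture.Cruxes.HLiu418.K2LiuRankOneWhittakerFECentre

variable {K : Type} [Field K] [NumberField K] {w : HeightOneSpectrum (𝓞 K)} {G : Type*} [Group G]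
variable [MeasurableSpace (w.adicCompletion K)] [BorelSpace (w.adicCompletion K)]
  (μ : Measure (w.adicCompletion K)) [μ.IsAddHaarMeasure]

/-- **THE FUNCTIONAL EQUATION AS AN IDENTITY OF REGULAR FAMILIES on `1 < re s`**: with the normalised intertwined family `N` (★ B7-S: `A_{e(s)}Φ_s = L(e(s)−1,ν)·N_s`) and the
evaluation letter `Γ^M_σ(e(s)) = L(e(s)−1,ν)·Γ̃(s)`, the functional equation of ★ W-FE-1b reads, after cancelling `L(e(s)−1,ν) ≠ 0`,
`Σ_a μ(𝔭^m) conj ψ(σa) N_s(w₀u(a)y) = Γ̃(s) · Σ_a μ(𝔭^m) conj ψ(σa) Φ_s(w₀u(a)y)`. [cite: CasselmanShalika1980, §4] [cite: Casselman1980, §3 Thm. 3.1] [cite: KudlaSweet1997, §1] -/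
theorem twistedHeadSum_eq_mul_on_halfPlane (Φ : ℂ → G → ℂ) {K' : Subgroup G} (hΦK : ∀ s : ℂ, 1 < s.re → ∀ g, ∀ k ∈ K', Φ s (g * k) = Φ s g)
    {u ū : w.adicCompletion K → G} (hu_add : ∀ x t, u (x + t) = u x * u t) (w₀ : G)
    (ν : (w.adicCompletion K)ˣ →* ℂˣ) (hν : ∀ x, ‖((ν x : ℂˣ) : ℂ)‖ = 1) (ae : ℕ) (ce : ℂ) (he : ∀ s : ℂ, 1 < s.re → 1 < ((ae : ℂ) * s + ce).re)
    (C₀ : ℂ → ℂ)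
    (hrel : ∀ s : ℂ, 1 < s.re → ∀ (x : (w.adicCompletion K)ˣ) (g : G),
      Φ s (w₀ * u x * g) = C₀ s * (((ν x)⁻¹ : ℂˣ) : ℂ) * ((normAbs (w.adicCompletion K) (x : w.adicCompletion K) : ℝ) : ℂ) ^ (-((ae : ℂ) * s + ce)) *
        Φ s (ū ((x⁻¹ : (w.adicCompletion K)ˣ) : w.adicCompletion K) * g))
    (κ : w.adicCompletion K) {kκ : ℤ} (hκ : normAbs (w.adicCompletion K) κ = (residueFieldCard (w.adicCompletion K) : ℝ≥0)⁻¹ ^ kκ)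
    (hword : ∀ r x' : w.adicCompletion K, ū r * (w₀ * u x') = w₀ * u (x' + κ * r))
    (T : ℂ → w.adicCompletion K → ℂ)
    (hT : ∀ (s : ℂ) (x : (w.adicCompletion K)ˣ), T s x = C₀ s * (((ν x)⁻¹ : ℂˣ) : ℂ) * ((normAbs (w.adicCompletion K) (x : w.adicCompletion K) : ℝ) : ℂ) ^ (-((ae : ℂ) * s + ce)))
    (cν : ℤ)
    (hνc : ∀ x : (w.adicCompletion K)ˣ, normAbs (w.adicCompletion K) (x : w.adicCompletion K) = 1 →
      (x : w.adicCompletion K) - 1 ∈ primePowBall (w.adicCompletion K) cν → ν x = 1)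
    (y : G) (m₀ : ℕ) (hmu : ∀ t ∈ primePowBall (w.adicCompletion K) (m₀ : ℤ), y⁻¹ * u t * y ∈ K')
    (hmū : ∀ t ∈ primePowBall (w.adicCompletion K) (m₀ : ℤ), y⁻¹ * ū t * y ∈ K')
    {ψ : AddChar (w.adicCompletion K) Circle} {cψ : ℤ} (hcψ : ψ.HasConductorExp cψ) {σ : w.adicCompletion K} {j : ℤ}
    (hσ : σ ∉ primePowBall (w.adicCompletion K) (cψ - j))
    (m : ℕ) (hm : m₀ ≤ m) (hσm : ∀ t ∈ primePowBall (w.adicCompletion K) (m : ℤ), ψ (σ * t) = 1)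
    {M : ℤ} (hm₀M : (m₀ : ℤ) ≤ M) (hjM : -M ≤ j) (hcM : cν - j - 1 ≤ M)
    (R : Finset (w.adicCompletion K))
    (hRinc : ∀ a ∈ R, ∀ a' ∈ R, a ≠ a' → a - a' ∉ primePowBall (w.adicCompletion K) (m : ℤ))
    (hRcov : primePowBall (w.adicCompletion K) (-M) = ⋃ a ∈ R, {x | x - a ∈ primePowBall (w.adicCompletion K) (m : ℤ)})
    (hintA : ∀ s : ℂ, 1 < s.re → ∀ a ∈ R, Integrable (fun x => Φ s (w₀ * u x * (w₀ * u a * y))) μ)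
    (N : ℂ → G → ℂ)
    (hN : ∀ s : ℂ, 1 < s.re → ∀ g, ∫ x, Φ s (w₀ * u x * g) ∂μ = lFactor K w ν ((ae : ℂ) * s + ce - 1) * N s g)
    (Γt : ℂ → ℂ)
    (hΓ : ∀ s : ℂ, 1 < s.re →
      ∫ x in (primePowBall (w.adicCompletion K) (M + kκ + 1))ᶜ, T s x * ((ψ (σ * (κ * x⁻¹)) : ℂ)) ∂μ = lFactor K w ν ((ae : ℂ) * s + ce - 1) * Γt s)
    (s : ℂ) (hs : 1 < s.re) :
    ∑ a ∈ R, (μ.real (primePowBall (w.adicCompletion K) (m : ℤ)) : ℂ) * (conj ((ψ (σ * a) : ℂ)) * N s (w₀ * u a * y)) =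
      Γt s * ∑ a ∈ R, (μ.real (primePowBall (w.adicCompletion K) (m : ℤ)) : ℂ) * (conj ((ψ (σ * a) : ℂ)) * Φ s (w₀ * u a * y)) := by
  -- the functional equation at `s` (★ W-FE-1b)
  have hFE := twistedHeadSum_intertwined_eq_mul μ (hΦK s hs) hu_add w₀ ν ((ae : ℂ) * s + ce) (C₀ s) (hrel s hs) κ hκ hword (T s) (hT s)
    cν hνc y m₀ hmu hmū hcψ hσ m hm hσm hm₀M hjM hcM R hRinc hRcov (hintA s hs)
  -- rewrite the intertwined values and the scalar through the `L`-factor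
  have hL : lFactor K w ν ((ae : ℂ) * s + ce - 1) ≠ 0 := lFactor_sub_one_ne_zero (norm_unramValue_le_one hν) (he s hs)
  have hlhs : ∑ a ∈ R, (μ.real (primePowBall (w.adicCompletion K) (m : ℤ)) : ℂ) * (conj ((ψ (σ * a) : ℂ)) * ∫ x, Φ s (w₀ * u x * (w₀ * u a * y)) ∂μ) =
      lFactor K w ν ((ae : ℂ) * s + ce - 1) *
        ∑ a ∈ R, (μ.real (primePowBall (w.adicCompletion K) (m : ℤ)) : ℂ) * (conj ((ψ (σ * a) : ℂ)) * N s (w₀ * u a * y)) := by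
    rw [Finset.mul_sum]
    refine Finset.sum_congr rfl fun a _ => ?_
    rw [hN s hs (w₀ * u a * y)]
    ring
  rw [hlhs, hΓ s hs, mul_assoc] at hFE
  exact mul_left_cancel₀ hL hFE

/-- **THE FUNCTIONAL EQUATION AT THE CENTRE `s = ½`** (identity principle, ★ F1 `eq_of_eqOn_halfPlane`): with the point values `s ↦ N_s(w₀u(a)y)`, `s ↦ Φ_s(w₀u(a)y)` (`a ∈ R`) and `Γ̃`
rational in `q₀^{-s}` (`q₀ ≥ 2`) and regular at `½`,
`Σ_a μ(𝔭^m) conj ψ(σa) N_{½}(w₀u(a)y) = Γ̃(½) · Σ_a μ(𝔭^m) conj ψ(σa) Φ_{½}(w₀u(a)y)`. [cite: CasselmanShalika1980, §4] [cite: KudlaSweet1997, §1] [cite: GanTakeda2011SiegelWeil, §7 Lemma 7.4] -/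
theorem twistedHeadSum_half_eq_mul (Φ : ℂ → G → ℂ) {K' : Subgroup G} (hΦK : ∀ s : ℂ, 1 < s.re → ∀ g, ∀ k ∈ K', Φ s (g * k) = Φ s g)
    {u ū : w.adicCompletion K → G} (hu_add : ∀ x t, u (x + t) = u x * u t) (w₀ : G)
    (ν : (w.adicCompletion K)ˣ →* ℂˣ) (hν : ∀ x, ‖((ν x : ℂˣ) : ℂ)‖ = 1) (ae : ℕ) (ce : ℂ) (he : ∀ s : ℂ, 1 < s.re → 1 < ((ae : ℂ) * s + ce).re)
    (C₀ : ℂ → ℂ)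
    (hrel : ∀ s : ℂ, 1 < s.re → ∀ (x : (w.adicCompletion K)ˣ) (g : G),
      Φ s (w₀ * u x * g) = C₀ s * (((ν x)⁻¹ : ℂˣ) : ℂ) * ((normAbs (w.adicCompletion K) (x : w.adicCompletion K) : ℝ) : ℂ) ^ (-((ae : ℂ) * s + ce)) *
        Φ s (ū ((x⁻¹ : (w.adicCompletion K)ˣ) : w.adicCompletion K) * g))
    (κ : w.adicCompletion K) {kκ : ℤ} (hκ : normAbs (w.adicCompletion K) κ = (residueFieldCard (w.adicCompletion K) : ℝ≥0)⁻¹ ^ kκ)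
    (hword : ∀ r x' : w.adicCompletion K, ū r * (w₀ * u x') = w₀ * u (x' + κ * r))
    (T : ℂ → w.adicCompletion K → ℂ)
    (hT : ∀ (s : ℂ) (x : (w.adicCompletion K)ˣ), T s x = C₀ s * (((ν x)⁻¹ : ℂˣ) : ℂ) * ((normAbs (w.adicCompletion K) (x : w.adicCompletion K) : ℝ) : ℂ) ^ (-((ae : ℂ) * s + ce)))
    (cν : ℤ)
    (hνc : ∀ x : (w.adicCompletion K)ˣ, normAbs (w.adicCompletion K) (x : w.adicCompletion K) = 1 →
      (x : w.adicCompletion K) - 1 ∈ primePowBall (w.adicCompletion K) cν → ν x = 1)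
    (y : G) (m₀ : ℕ) (hmu : ∀ t ∈ primePowBall (w.adicCompletion K) (m₀ : ℤ), y⁻¹ * u t * y ∈ K')
    (hmū : ∀ t ∈ primePowBall (w.adicCompletion K) (m₀ : ℤ), y⁻¹ * ū t * y ∈ K')
    {ψ : AddChar (w.adicCompletion K) Circle} {cψ : ℤ} (hcψ : ψ.HasConductorExp cψ) {σ : w.adicCompletion K} {j : ℤ}
    (hσ : σ ∉ primePowBall (w.adicCompletion K) (cψ - j))
    (m : ℕ) (hm : m₀ ≤ m) (hσm : ∀ t ∈ primePowBall (w.adicCompletion K) (m : ℤ), ψ (σ * t) = 1)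
    {M : ℤ} (hm₀M : (m₀ : ℤ) ≤ M) (hjM : -M ≤ j) (hcM : cν - j - 1 ≤ M)
    (R : Finset (w.adicCompletion K))
    (hRinc : ∀ a ∈ R, ∀ a' ∈ R, a ≠ a' → a - a' ∉ primePowBall (w.adicCompletion K) (m : ℤ))
    (hRcov : primePowBall (w.adicCompletion K) (-M) = ⋃ a ∈ R, {x | x - a ∈ primePowBall (w.adicCompletion K) (m : ℤ)})
    (hintA : ∀ s : ℂ, 1 < s.re → ∀ a ∈ R, Integrable (fun x => Φ s (w₀ * u x * (w₀ * u a * y))) μ)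
    (N : ℂ → G → ℂ)
    (hN : ∀ s : ℂ, 1 < s.re → ∀ g, ∫ x, Φ s (w₀ * u x * g) ∂μ = lFactor K w ν ((ae : ℂ) * s + ce - 1) * N s g)
    {q₀ : ℕ} (hq₀ : 2 ≤ q₀)
    (hNreg : ∀ a ∈ R, IsQRationalRegularAt q₀ (1 / 2) fun s => N s (w₀ * u a * y))
    (hΦreg : ∀ a ∈ R, IsQRationalRegularAt q₀ (1 / 2) fun s => Φ s (w₀ * u a * y))
    (Γt : ℂ → ℂ)
    (hΓ : ∀ s : ℂ, 1 < s.re →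
      ∫ x in (primePowBall (w.adicCompletion K) (M + kκ + 1))ᶜ, T s x * ((ψ (σ * (κ * x⁻¹)) : ℂ)) ∂μ = lFactor K w ν ((ae : ℂ) * s + ce - 1) * Γt s)
    (hΓreg : IsQRationalRegularAt q₀ (1 / 2) Γt) :
    ∑ a ∈ R, (μ.real (primePowBall (w.adicCompletion K) (m : ℤ)) : ℂ) * (conj ((ψ (σ * a) : ℂ)) * N (1 / 2) (w₀ * u a * y)) =
      Γt (1 / 2) * ∑ a ∈ R, (μ.real (primePowBall (w.adicCompletion K) (m : ℤ)) : ℂ) * (conj ((ψ (σ * a) : ℂ)) * Φ (1 / 2) (w₀ * u a * y)) := by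
  -- both sides are rational in `q₀^{-s}` and regular at `½`
  have hL : IsQRationalRegularAt q₀ (1 / 2) fun s =>
      ∑ a ∈ R, (μ.real (primePowBall (w.adicCompletion K) (m : ℤ)) : ℂ) * (conj ((ψ (σ * a) : ℂ)) * N s (w₀ * u a * y)) :=
    IsQRationalRegularAt.sum R (Φ := fun a s => (μ.real (primePowBall (w.adicCompletion K) (m : ℤ)) : ℂ) * (conj ((ψ (σ * a) : ℂ)) * N s (w₀ * u a * y)))
      fun a ha => ((hNreg a ha).const_mul _).const_mul _
  have hR : IsQRationalRegularAt q₀ (1 / 2) fun s =>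
      Γt s * ∑ a ∈ R, (μ.real (primePowBall (w.adicCompletion K) (m : ℤ)) : ℂ) * (conj ((ψ (σ * a) : ℂ)) * Φ s (w₀ * u a * y)) :=
    hΓreg.mul (IsQRationalRegularAt.sum R (Φ := fun a s => (μ.real (primePowBall (w.adicCompletion K) (m : ℤ)) : ℂ) * (conj ((ψ (σ * a) : ℂ)) * Φ s (w₀ * u a * y)))
      fun a ha => ((hΦreg a ha).const_mul _).const_mul _)
  exact hL.eq_of_eqOn_halfPlane hq₀ hR 1 fun s hs =>
    twistedHeadSum_eq_mul_on_halfPlane μ Φ hΦK hu_add w₀ ν hν ae ce he C₀ hrel κ hκ hword T hT cν hνc y m₀ hmu hmū hcψ hσ m hm hσm hm₀M hjM hcM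
      R hRinc hRcov hintA N hN Γt hΓ s hs

/-- **KERNEL TRANSFER AT THE CENTRE (the (L-N1) replacement, non-split places)**: if, in addition, the normalised intertwined family DIES at `s = ½` along `w₀ u(·) y`
(`N_{½}(w₀u(a)y) = 0` for `a ∈ R` — U1-glob's kernel clause transported to ★ B7-S's `N` by ★ B2a-core's identity principle) and the evaluation letter has `Γ̃(½) ≠ 0`
(W-FE-2b∕2c), then the ψ_σ-TWISTED STAGE OF THE FAMILY AT THE CENTRE VANISHES:
`Σ_{a∈R} μ(𝔭^m) conj ψ(σa) Φ_{½}(w₀ u(a) y) = 0` — B2b's `hFn0` at the place, with no injectivity of `N^{(1)}(0)` used.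
[cite: CasselmanShalika1980, §4] [cite: GanTakeda2011SiegelWeil, §7 Lemma 7.4] [cite: KudlaRallis1994, §2] [cite: Casselman1980, §3 Thm. 3.1] -/
theorem twistedHeadSum_half_eq_zero_of_normalised_half_eq_zero (Φ : ℂ → G → ℂ) {K' : Subgroup G}
    (hΦK : ∀ s : ℂ, 1 < s.re → ∀ g, ∀ k ∈ K', Φ s (g * k) = Φ s g)
    {u ū : w.adicCompletion K → G} (hu_add : ∀ x t, u (x + t) = u x * u t) (w₀ : G)
    (ν : (w.adicCompletion K)ˣ →* ℂˣ) (hν : ∀ x, ‖((ν x : ℂˣ) : ℂ)‖ = 1) (ae : ℕ) (ce : ℂ) (he : ∀ s : ℂ, 1 < s.re → 1 < ((ae : ℂ) * s + ce).re)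
    (C₀ : ℂ → ℂ)
    (hrel : ∀ s : ℂ, 1 < s.re → ∀ (x : (w.adicCompletion K)ˣ) (g : G),
      Φ s (w₀ * u x * g) = C₀ s * (((ν x)⁻¹ : ℂˣ) : ℂ) * ((normAbs (w.adicCompletion K) (x : w.adicCompletion K) : ℝ) : ℂ) ^ (-((ae : ℂ) * s + ce)) *
        Φ s (ū ((x⁻¹ : (w.adicCompletion K)ˣ) : w.adicCompletion K) * g))
    (κ : w.adicCompletion K) {kκ : ℤ} (hκ : normAbs (w.adicCompletion K) κ = (residueFieldCard (w.adicCompletion K) : ℝ≥0)⁻¹ ^ kκ)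
    (hword : ∀ r x' : w.adicCompletion K, ū r * (w₀ * u x') = w₀ * u (x' + κ * r))
    (T : ℂ → w.adicCompletion K → ℂ)
    (hT : ∀ (s : ℂ) (x : (w.adicCompletion K)ˣ), T s x = C₀ s * (((ν x)⁻¹ : ℂˣ) : ℂ) * ((normAbs (w.adicCompletion K) (x : w.adicCompletion K) : ℝ) : ℂ) ^ (-((ae : ℂ) * s + ce)))
    (cν : ℤ)
    (hνc : ∀ x : (w.adicCompletion K)ˣ, normAbs (w.adicCompletion K) (x : w.adicCompletion K) = 1 →
      (x : w.adicCompletion K) - 1 ∈ primePowBall (w.adicCompletion K) cν → ν x = 1)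
    (y : G) (m₀ : ℕ) (hmu : ∀ t ∈ primePowBall (w.adicCompletion K) (m₀ : ℤ), y⁻¹ * u t * y ∈ K')
    (hmū : ∀ t ∈ primePowBall (w.adicCompletion K) (m₀ : ℤ), y⁻¹ * ū t * y ∈ K')
    {ψ : AddChar (w.adicCompletion K) Circle} {cψ : ℤ} (hcψ : ψ.HasConductorExp cψ) {σ : w.adicCompletion K} {j : ℤ}
    (hσ : σ ∉ primePowBall (w.adicCompletion K) (cψ - j))
    (m : ℕ) (hm : m₀ ≤ m) (hσm : ∀ t ∈ primePowBall (w.adicCompletion K) (m : ℤ), ψ (σ * t) = 1)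
    {M : ℤ} (hm₀M : (m₀ : ℤ) ≤ M) (hjM : -M ≤ j) (hcM : cν - j - 1 ≤ M)
    (R : Finset (w.adicCompletion K))
    (hRinc : ∀ a ∈ R, ∀ a' ∈ R, a ≠ a' → a - a' ∉ primePowBall (w.adicCompletion K) (m : ℤ))
    (hRcov : primePowBall (w.adicCompletion K) (-M) = ⋃ a ∈ R, {x | x - a ∈ primePowBall (w.adicCompletion K) (m : ℤ)})
    (hintA : ∀ s : ℂ, 1 < s.re → ∀ a ∈ R, Integrable (fun x => Φ s (w₀ * u x * (w₀ * u a * y))) μ)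
    (N : ℂ → G → ℂ)
    (hN : ∀ s : ℂ, 1 < s.re → ∀ g, ∫ x, Φ s (w₀ * u x * g) ∂μ = lFactor K w ν ((ae : ℂ) * s + ce - 1) * N s g)
    {q₀ : ℕ} (hq₀ : 2 ≤ q₀)
    (hNreg : ∀ a ∈ R, IsQRationalRegularAt q₀ (1 / 2) fun s => N s (w₀ * u a * y))
    (hΦreg : ∀ a ∈ R, IsQRationalRegularAt q₀ (1 / 2) fun s => Φ s (w₀ * u a * y))
    (Γt : ℂ → ℂ)
    (hΓ : ∀ s : ℂ, 1 < s.re →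
      ∫ x in (primePowBall (w.adicCompletion K) (M + kκ + 1))ᶜ, T s x * ((ψ (σ * (κ * x⁻¹)) : ℂ)) ∂μ = lFactor K w ν ((ae : ℂ) * s + ce - 1) * Γt s)
    (hΓreg : IsQRationalRegularAt q₀ (1 / 2) Γt) (hΓ0 : Γt (1 / 2) ≠ 0)
    (hN0 : ∀ a ∈ R, N (1 / 2) (w₀ * u a * y) = 0) :
    ∑ a ∈ R, (μ.real (primePowBall (w.adicCompletion K) (m : ℤ)) : ℂ) * (conj ((ψ (σ * a) : ℂ)) * Φ (1 / 2) (w₀ * u a * y)) = 0 := by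
  have h := twistedHeadSum_half_eq_mul μ Φ hΦK hu_add w₀ ν hν ae ce he C₀ hrel κ hκ hword T hT cν hνc y m₀ hmu hmū hcψ hσ m hm hσm hm₀M hjM hcM
    R hRinc hRcov hintA N hN hq₀ hNreg hΦreg Γt hΓ hΓreg
  have hzero : ∑ a ∈ R, (μ.real (primePowBall (w.adicCompletion K) (m : ℤ)) : ℂ) * (conj ((ψ (σ * a) : ℂ)) * N (1 / 2) (w₀ * u a * y)) = 0 :=
    Finset.sum_eq_zero fun a ha => by rw [hN0 a ha, mul_zero, mul_zero]
  rw [hzero] at h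
  exact (mul_eq_zero.1 h.symm).resolve_left hΓ0

end Summit.HodgeConjecture.HodgeConjecture.Cruxes.HLiu418.K2LiuRankOneWhittakerFECentre

end
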